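import Summits.BirchSwinnertonDyer.BirchSwinnertonDyer.Theorems.EisensteinPrimesMazurMCOnX1RankZeroLocate
import Summits.BirchSwinnertonDyer.Rank1Residual.X1.MuPart
import Literature.NumberTheory.EllipticCurves.Rank1Residual.ClassX1Isogeny
import Literature.NumberTheory.EllipticCurves.GreenbergVatsal2000.CongruentCurves
import Literature.NumberTheory.EllipticCurves.KatoRankBoundProofs
import Literature.NumberTheory.EllipticCurves.IwasawaSelmerDualProofs
import HarnessLib

/-!
# Crux `MazurMCOnX1RankZero` (stmt-BirchSwinnertonDyer-19035), line `mudescent`, stub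
# `stub_analyticMuZero_offLocus`: the stub DECOMPOSED — on the leaf, «μ_an = 0» is EXACTLY
# «μ-part of Mazur's main conjecture» ∧ «μ(X(E/ℚ_∞)) = 0» (cell `bsd-eis`, seat `bsd-eis-mu-b`,
# PROGRAMME PART 1b seat (2); CONSTRUCTION seat, open-problem grade — this file closes NO stub)

Companion of `EisensteinPrimesMazurMCOnX1RankZeroAnalyticMuOffLocus.lean` (same seat; §3 there: the stub
IMPLIES Greenberg's Conjecture 1.11 on the leaf). Here the converse bookkeeping is done, so that the open
stub of line `mudescent`,

  `∀ W₀ p, ClassX1 W₀ p → W₀.analyticRank = 0 → ¬ HasRamifiedOddLineAt W₀ p → X1.MuPart.AnalyticMuLE W₀ p 0`,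

is identified, in the kernel and modulo two PUBLISHED facts (Wuthrich 2014 Thm. 16 `hW16`; modularity
`hmod`, only for one direction), with the CONJUNCTION of two statements that have names in print:
* (M) the **μ-part of Mazur's main conjecture** at the member, `X1.MuLambda.MuPartAt W p` (`μ(g·h) ≤ μ(g)`
  for Wuthrich's factorisation `ϖ·L_p(f,α) = ι(g·h)`, `char X = (g)`; the reverse inequality is Kato's) —
  the μ-half of line `katoky`'s `stub_muLambda` (Keller–Yin 2024 Thm. 3.0.10 claims the whole main
  conjecture; PREPRINT), and
* (G) **Greenberg's μ-conjecture AT the member**: `D.mu = 0` for every cyclotomic dual datum (LNM 1716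
  Conj. 1.11 predicts exactly this member, the «étale end»; OPEN: Ray 2023 §6 «expected … not proved»,
  Trifković 2005 Conj. 2).
`analyticMuLE_zero_iff_muPartAt_and_mu_eq_zero`: on the leaf, `AnalyticMuLE W p 0 ↔ (M) ∧ (G)`. Reading:
`μ_an = μ(g·h) = μ(g) + μ(h) = μ(X) + μ(h)`, and (M) is `μ(h) = 0`; so «`μ_an(W₀) = 0`» = «`μ_alg(W₀) = 0`»
+ «the Kato–Wuthrich cofactor `h` has `μ = 0`». Consequently (`stub_iff_muPart_and_greenbergMu_offLocus`)
the registered stub is EQUIVALENT to: at every off-locus rank-`0` X1 member, (M) and (G). Under the main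
conjecture at `W₀` (the crux itself / KY24) the stub is therefore EQUIVALENT to Conj. 1.11 at `W₀`;
unconditionally it is the strictly more informative analytic face. Nothing here proves (M) or (G).

WHAT IS PRINTED: Greenberg–Vatsal 2000 p. 4 («`f_E^{alg}` divides `f_E^{anal}`», Kato) and (1)–(2)
(`μ` as the exact power of `p`); Wuthrich 2014 Thm. 16 (integral divisibility at reducible good ordinary
`p`); Greenberg LNM 1716 Conj. 1.11; the decomposition itself is bookkeeping (no source claims it as a
theorem; none is needed). HONEST FRAMING: theorems only, no `def`, no named fact, no `sorry`; closes
nothing; no label or count moves. References: [GreenbergVatsal2000] p. 2 (1)–(2), p. 4;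
[Wuthrich2014] Thm. 16; [GreenbergLNM1716] Conj. 1.11; [BCDTJAMS2001] Thm. A; [KellerYin2024] Thm. 3.0.10
(PRE); HOME `run/shared/lean/pub/bsd-eis/mu-b-MEMO-1.md` §2(h).
-/

set_option autoImplicit false

-- `Summit.BirchSwinnertonDyer.BirchSwinnertonDyer.…`: the summit and its single sub-problem share a name (D-0017 layout).
set_option linter.dupNamespace false

noncomputable section

open scoped Classical MatrixGroups ModularForm

open CongruenceSubgroup WeierstrassCurve
  Literature.NumberTheory.EllipticCurves Literature.NumberTheory.EllipticCurves.ModularForms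
  Literature.NumberTheory.EllipticCurves.Rank1Residual
  Literature.NumberTheory.EllipticCurves.GreenbergVatsal2000
  Literature.Barriers.BirchSwinnertonDyer
  Summit.BirchSwinnertonDyer.Rank1Residual
  Summit.BirchSwinnertonDyer.Rank1Residual.X1.MuLambda
  Summit.BirchSwinnertonDyer.Rank1Residual.X1.MuPart
  Summit.BirchSwinnertonDyer.Rank1Residual.X1.MuStructure
  Summit.BirchSwinnertonDyer.BirchSwinnertonDyer.Theorems

namespace Summit.BirchSwinnertonDyer.BirchSwinnertonDyer.Theorems.EisensteinPrimesMazurMCOnX1RankZeroAnalyticMuDecomposition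

variable {W : WeierstrassCurve ℚ} [W.IsElliptic] [W.IsGloballyMinimal] {p : ℕ} [hp : Fact p.Prime]

/-! ## §1 (M) ∧ (G) ⇒ `μ_an = 0` (Wuthrich Thm. 16 only; no modularity needed in this direction) -/

/-- **From the μ-part of the main conjecture and `μ(X(E/ℚ_∞)) = 0` to the certificate `μ_an = 0`.**
At a good ordinary Eisenstein pair `(E,p)`, `p ≠ 2`, granted Wuthrich 2014 Thm. 16 (`hW16`): if
`MuPartAt W p` (`μ(g·h) ≤ μ(g)` for every factorisation `ϖ·L_p(f,α) = ι(g·h)`, `char X = (g)`) and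
`μ(X(E/ℚ_∞)) = 0` for every cyclotomic dual datum, then `AnalyticMuLE W p 0`: for the given newform and
`ϖ`, pick the cyclotomic data (`exists_isCyclotomic_isTopGenerator_isCyclotomicVariable_holds`) and a dual
datum; Thm. 16 gives `ϖ·L_p = ι(g')`, `g' ∈ char X = (g)`, so `g' = g·h`; `μ(g) = μ(X) = 0`
(`mu_generator_eq_muInvariant`) and (M) give `μ(g·h) = 0`, i.e. `p ∤ g·h`, i.e. unit content: some
coefficient of `ι(g·h) = ϖ·L_p` has norm `1 > p⁻¹`. [cite: Wuthrich2014, Thm. 16 (p. 397)]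
[cite: GreenbergVatsal2000, p. 2 (1)–(2)] -/
theorem analyticMuLE_zero_of_muPartAt_of_mu_eq_zero (hW16 : Wuthrich2014.charIdeal_dvd_padicLFunction)
    (hp2 : p ≠ 2) (hgood : W.HasGoodReductionAtPrime p) (hord : ¬ (p : ℤ) ∣ W.frobeniusTrace p)
    (hred : ¬ W.HasIrreducibleModPGaloisRep p) (hM : MuPartAt W p)
    (hG : ∀ (κ : ZpExtension ℚ p) (γ : Field.absoluteGaloisGroup ℚ),
      κ.IsCyclotomic → κ.IsTopGenerator γ → IsCyclotomicVariable p γ →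
      ∀ D : W.SelmerDualData κ γ, D.mu = 0) :
    AnalyticMuLE W p 0 := by
  intro _ f hf ϖ hϖ
  have hpP : p.Prime := Fact.out
  obtain ⟨κ, hκ, γ, hγ, hγ'⟩ := exists_isCyclotomic_isTopGenerator_isCyclotomicVariable_holds p
  obtain ⟨D⟩ := W.nonempty_selmerDualData_holds κ γ hγ
  haveI : Module.Finite (IwasawaAlgebra p) D.X := D.module_finite_holds hγ
  obtain ⟨hD, g', hg'mem, hι'⟩ := hW16 W p hp2 ⟨hgood, hord⟩ hred hκ hγ hγ' hf D ϖ hϖ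
  obtain ⟨g, hg⟩ := (charIdeal_isPrincipal_holds p D.X).principal
  have hchar : D.charIdeal = Ideal.span {g} := hg
  have hdvd : g ∣ g' := by
    rw [hchar] at hg'mem
    exact Ideal.mem_span_singleton.mp hg'mem
  obtain ⟨h, rfl⟩ := hdvd
  have hgh : g * h ≠ 0 := mul_ne_zero_of_iota_eq hgood hord hf hϖ D hι'
  have hg0 : g ≠ 0 := fun h0 => hgh (by rw [h0, zero_mul])
  -- `μ(g) = μ(X) = 0`
  have hμg : mu g = 0 := by
    have h0 := hG κ γ hκ hγ hγ' D
    rw [SelmerDualData.mu] at h0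
    rw [mu_generator_eq_muInvariant D.X hD hg0 hchar, h0]
  -- (M): `μ(g·h) ≤ μ(g) = 0`
  have hμgh : mu (g * h) = 0 := Nat.le_zero.mp (hμg ▸ hM κ γ hκ hγ hγ' f hf ϖ hϖ D g h hchar hι')
  -- hence `p ∤ g·h`, unit content, a coefficient of norm `1`
  have hndvd : ¬ PowerSeries.C (p : ℤ_[p]) ∣ g * h := by
    intro hdvd
    have h1 : 1 ≤ mu (g * h) := le_mu_of_C_pow_dvd hgh (by rw [pow_one]; exact hdvd)
    omega
  obtain ⟨n, hn⟩ := (hasUnitContent_iff_exists_norm_coeff_map_eq_one (g * h)).mp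
    ((hasUnitContent_iff_not_C_dvd (g * h)).mpr hndvd)
  refine ⟨n, ?_⟩
  rw [← hι', hn, Nat.cast_zero, zero_add, zpow_neg, zpow_one]
  exact inv_lt_one_of_one_lt₀ (by exact_mod_cast hpP.one_lt)

/-! ## §2 On the leaf: `μ_an = 0` ⟺ (M) ∧ (G) -/

/-- **The analytic certificate decomposed on the leaf.** For a leaf pair `(E,p)` (X1 ∧ `r_an = 0`),
granted Wuthrich 2014 Thm. 16 (`hW16`) and modularity (`hmod`, used only for ⇒):
`AnalyticMuLE W p 0 ↔ MuPartAt W p ∧ (∀ cyclotomic dual data D, D.mu = 0)` — «`μ_an = 0`» is EXACTLY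
«the μ-part of Mazur's main conjecture at `(E,p)`» ∧ «Greenberg's `μ = 0` at `E`». (⇒: the tree's
`X1.MuPart.muPartAt_of_analyticMuLE_zero` and `mu_eq_zero_of_analyticMuLE_zero`; ⇐: §1.) So at the étale
end `W₀` the open stub of line `mudescent` splits into the μ-half of line `katoky`'s `stub_muLambda` at `W₀`
(claimed by Keller–Yin 2024 Thm. 3.0.10, PREPRINT) and LNM 1716 Conj. 1.11 at `W₀` (OPEN).
[cite: Wuthrich2014, Thm. 16 (p. 397)] [cite: GreenbergLNM1716, Conj. 1.11 (p. 58)]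
[cite: GreenbergVatsal2000, p. 2 (1)–(2) and p. 4] [cite: BCDTJAMS2001, Theorem A] -/
theorem analyticMuLE_zero_iff_muPartAt_and_mu_eq_zero (hW16 : Wuthrich2014.charIdeal_dvd_padicLFunction)
    (hmod : nonempty_modularParametrizationData) (hL : X1.RankZero.Leaf W p) :
    AnalyticMuLE W p 0 ↔
      MuPartAt W p ∧ ∀ (κ : ZpExtension ℚ p) (γ : Field.absoluteGaloisGroup ℚ),
        κ.IsCyclotomic → κ.IsTopGenerator γ → IsCyclotomicVariable p γ →
        ∀ D : W.SelmerDualData κ γ, D.mu = 0 := by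
  have hX := isClassX1_of_classX1 hL.classX1
  refine ⟨fun han ↦ ⟨Leaf.muPartAt_of_analyticMuLE_zero hW16 hL han, fun κ γ hκ hγ hγ' D ↦ ?_⟩,
    fun h ↦ analyticMuLE_zero_of_muPartAt_of_mu_eq_zero hW16 hX.two_ne hX.hasGoodReductionAtPrime
      hX.not_dvd_frobeniusTrace hX.not_hasIrreducibleModPGaloisRep h.1 h.2⟩
  exact mu_eq_zero_of_analyticMuLE_zero hW16 hmod hX.two_ne hX.hasGoodReductionAtPrime
    hX.not_dvd_frobeniusTrace hX.not_hasIrreducibleModPGaloisRep han hκ hγ hγ' D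

/-! ## §3 The registered stub, decomposed -/

/-- **`stub_analyticMuZero_offLocus` ⟺ (μ-part of Mazur's MC at every étale end) ∧ (Greenberg's
`μ = 0` at every étale end)**, granted Wuthrich Thm. 16 and modularity. Left side: verbatim the
registered signature of the stub of line `mudescent` on stmt-BirchSwinnertonDyer-19035. Right side, first
conjunct: `X1.MuLambda.MuPartAt W₀ p` at every rank-`0` X1 member off the barrier locus (the μ-half of
`katoky`'s `stub_muLambda` there); second conjunct: `μ(X(W₀/ℚ_∞)) = 0` at every such member, i.e.
LNM 1716 Conj. 1.11 in its located form (the companion file's `greenbergMu_onLeaf_of_stub` derives the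
printed isogeny form from it). The decomposition is exact: neither conjunct is implied by the other on the
tree, neither is in print. [cite: GreenbergLNM1716, Conj. 1.11 (p. 58)] [cite: Wuthrich2014, Thm. 16 (p. 397)]
[cite: KellerYin2024, Thm. 3.0.10 (announced statement; shape only; nothing asserted)] -/
theorem stub_iff_muPart_and_greenbergMu_offLocus (hW16 : Wuthrich2014.charIdeal_dvd_padicLFunction)
    (hmod : nonempty_modularParametrizationData) :
    (∀ (W₀ : WeierstrassCurve ℚ) [W₀.IsElliptic] [W₀.IsGloballyMinimal] (p : ℕ) [Fact p.Prime],
        ClassX1 W₀ p → W₀.analyticRank = 0 → ¬ HasRamifiedOddLineAt W₀ p → AnalyticMuLE W₀ p 0) ↔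
      (∀ (W₀ : WeierstrassCurve ℚ) [W₀.IsElliptic] [W₀.IsGloballyMinimal] (p : ℕ) [Fact p.Prime],
          ClassX1 W₀ p → W₀.analyticRank = 0 → ¬ HasRamifiedOddLineAt W₀ p → MuPartAt W₀ p) ∧
        ∀ (W₀ : WeierstrassCurve ℚ) [W₀.IsElliptic] [W₀.IsGloballyMinimal] (p : ℕ) [Fact p.Prime],
          ClassX1 W₀ p → W₀.analyticRank = 0 → ¬ HasRamifiedOddLineAt W₀ p →
          ∀ (κ : ZpExtension ℚ p) (γ : Field.absoluteGaloisGroup ℚ),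
            κ.IsCyclotomic → κ.IsTopGenerator γ → IsCyclotomicVariable p γ →
            ∀ D : W₀.SelmerDualData κ γ, D.mu = 0 := by
  refine ⟨fun h ↦ ⟨fun W₀ _ _ p _ hX1 hr0 hoff ↦ ?_, fun W₀ _ _ p _ hX1 hr0 hoff ↦ ?_⟩,
    fun h W₀ _ _ p _ hX1 hr0 hoff ↦ ?_⟩
  · exact ((analyticMuLE_zero_iff_muPartAt_and_mu_eq_zero hW16 hmod ⟨hX1, hr0⟩).mp
      (h W₀ p hX1 hr0 hoff)).1
  · exact ((analyticMuLE_zero_iff_muPartAt_and_mu_eq_zero hW16 hmod ⟨hX1, hr0⟩).mp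
      (h W₀ p hX1 hr0 hoff)).2
  · exact (analyticMuLE_zero_iff_muPartAt_and_mu_eq_zero hW16 hmod ⟨hX1, hr0⟩).mpr
      ⟨h.1 W₀ p hX1 hr0 hoff, h.2 W₀ p hX1 hr0 hoff⟩

/-- **Under the main conjecture's μ-part at the étale ends, the stub IS Greenberg's conjecture there**
(one of the two readings of §3 spelled out): granted `hW16`, `hmod` and (M) at every off-locus rank-`0`
X1 member, `stub_analyticMuZero_offLocus` ⟺ `μ(X(W₀/ℚ_∞)) = 0` at every such member. With KY24
Thm. 3.0.10 (PRE) supplying (M), the analytic stub and the located Conj. 1.11 coincide on the leaf.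
[cite: GreenbergLNM1716, Conj. 1.11 (p. 58)] [cite: KellerYin2024, Thm. 3.0.10 (announced statement; shape only; nothing asserted)] -/
theorem stub_iff_greenbergMu_offLocus_of_muPart (hW16 : Wuthrich2014.charIdeal_dvd_padicLFunction)
    (hmod : nonempty_modularParametrizationData)
    (hM : ∀ (W₀ : WeierstrassCurve ℚ) [W₀.IsElliptic] [W₀.IsGloballyMinimal] (p : ℕ) [Fact p.Prime],
      ClassX1 W₀ p → W₀.analyticRank = 0 → ¬ HasRamifiedOddLineAt W₀ p → MuPartAt W₀ p) :
    (∀ (W₀ : WeierstrassCurve ℚ) [W₀.IsElliptic] [W₀.IsGloballyMinimal] (p : ℕ) [Fact p.Prime],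
        ClassX1 W₀ p → W₀.analyticRank = 0 → ¬ HasRamifiedOddLineAt W₀ p → AnalyticMuLE W₀ p 0) ↔
      ∀ (W₀ : WeierstrassCurve ℚ) [W₀.IsElliptic] [W₀.IsGloballyMinimal] (p : ℕ) [Fact p.Prime],
        ClassX1 W₀ p → W₀.analyticRank = 0 → ¬ HasRamifiedOddLineAt W₀ p →
        ∀ (κ : ZpExtension ℚ p) (γ : Field.absoluteGaloisGroup ℚ),
          κ.IsCyclotomic → κ.IsTopGenerator γ → IsCyclotomicVariable p γ →
          ∀ D : W₀.SelmerDualData κ γ, D.mu = 0 := by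
  rw [stub_iff_muPart_and_greenbergMu_offLocus hW16 hmod]
  exact ⟨fun h ↦ h.2, fun h ↦ ⟨hM, h⟩⟩

end Summit.BirchSwinnertonDyer.BirchSwinnertonDyer.Theorems.EisensteinPrimesMazurMCOnX1RankZeroAnalyticMuDecomposition

end
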